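import Mathlib
import HarnessLib
import HarnessLib.Audit

/-!
# Route `IntegerScrew` — TYPED STATEMENT of LEMMA K (the smooth-sector inequality of the floor-constant
pencil; SCREW column row S-P (P1), RH-FREE)

Source: rh-explicit-screw-matvec-1 gen12, `TRIAL-BOUND-THEOREM.md` Addendum 3 (iii), (v), (vii) and
`ANATOMY-C-INFINITY.md` §11 (A6 lineage C).  In the unified second-order pencil of the screw matrices
`S_M` the SMOOTH sector consists of the «lattice profiles» `h(y) = Σ_{n ≤ 1/y} g(ny)` of a `C¹`
generator `g` on `[0,1]` with `g(1) = 0`, `∫₀¹ g = 0` (boundedness) and `∫₀¹ g(u) u^{-1/2} du = 0`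
(the `ζ`-divisibility / `O(1)`-sum admissibility condition); its plateau is `h₀ := h(0⁺) = −g(0)/2`
(Euler–Maclaurin), and its leading Rayleigh constant is `(1 + κ(h))/12` with
`κ(h) := ∫₀¹ (h − h₀)² y⁻² dy / h₀²`.  LEMMA K says `κ(h) ≥ K` for every admissible `g`, with
`K = 8.4924` (kit j237662) and `K = 8.651` (kit j238785) CERTIFIED by ball arithmetic through a
Mellin–Parseval relaxation to a three-node weighted interpolation problem with weight `|ζ(3/2+it)|²`;
the structural threshold is `K > 2` (then `(1+κ)/12 > 1/4 = ψ(2)/12`, i.e. the smooth sector never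
competes with the flat eta direction at leading order — the «why 1/4» of lineage C's §11(v)).

LABEL (ladder rule §5.4): RH-FREE — a statement of real analysis about finite lattice sums of a `C¹`
function; no zeta value occurs in it (ζ enters only the certified proof, as a Mellin weight).  Status:
CERTIFIED (interval arithmetic), NOT a kernel theorem; typed here so that the column can cite the exact
sentence.  Nothing in this file bears on the truth of RH.

* `latticeProfile g y = Σ_{n=1}^{⌊1/y⌋} g(n·y)`;
* `SmoothSectorAdmissible g` — the four side conditions on `g`;
* `SmoothSectorKInequality K` — `∀ g` admissible, if `(h − h₀)²/y²` is integrable on `(0,1)` then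
  `K·h₀² ≤ ∫₀¹ (h − h₀)² y⁻² dy` (for admissible `g` the integrand is bounded near `0`, so the
  integrability proviso only excludes nothing of interest; it keeps the Bochner integral honest);
* `ScrewSmoothSectorKTwo` (`K = 2`, the structural threshold) and `ScrewSmoothSectorKCertified`
  (`K = 8.4924`, the weaker of the two certified constants), both `@[conjecture]` = typed, unproved
  in the kernel; `screwSmoothSectorKTwo_of_certified` (monotonicity in `K`).
-/

noncomputable section

-- D-0017: `Summit.<S>.<S>.…` is the designed namespace of a single-problem summit.
set_option linter.dupNamespace false

namespace Summit.RiemannHypothesis.RiemannHypothesis.Theorems.IntegerScrew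

open MeasureTheory Set Finset
open scoped BigOperators

/-- The LATTICE PROFILE of a generator `g`: `h(y) = Σ_{n=1}^{⌊1/y⌋} g(n y)` (`y > 0`; for `y > 1` the
sum is empty). [folklore] -/
def latticeProfile (g : ℝ → ℝ) (y : ℝ) : ℝ :=
  ∑ n ∈ Finset.Icc 1 ⌊1 / y⌋₊, g (n * y)

/-- The PLATEAU `h₀ := h(0⁺) = −g(0)/2` of the lattice profile of an admissible generator
(Euler–Maclaurin with `∫₀¹ g = 0`, `g(1) = 0`). [folklore] -/
def latticePlateau (g : ℝ → ℝ) : ℝ := -(g 0) / 2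

/-- ADMISSIBILITY of a smooth-sector generator: `g ∈ C¹[0,1]`, `g(1) = 0`, `∫₀¹ g = 0`,
`∫₀¹ g(u) u^{−1/2} du = 0`. [folklore] -/
def SmoothSectorAdmissible (g : ℝ → ℝ) : Prop :=
  ContDiffOn ℝ 1 g (Set.Icc 0 1) ∧ g 1 = 0 ∧ (∫ u in (0:ℝ)..1, g u) = 0 ∧
    (∫ u in (0:ℝ)..1, g u * u ^ (-(1 / 2 : ℝ))) = 0

/-- LEMMA K with constant `K`: for every admissible `g` whose normalised profile deviation
`(h − h₀)²/y²` is integrable on `(0,1)`, `K · h₀² ≤ ∫₀¹ (h(y) − h₀)² y⁻² dy`. [folklore] -/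
def SmoothSectorKInequality (K : ℝ) : Prop :=
  ∀ g : ℝ → ℝ, SmoothSectorAdmissible g →
    IntegrableOn (fun y => (latticeProfile g y - latticePlateau g) ^ 2 / y ^ 2) (Set.Ioo 0 1) →
      K * latticePlateau g ^ 2 ≤
        ∫ y in Set.Ioo (0:ℝ) 1, (latticeProfile g y - latticePlateau g) ^ 2 / y ^ 2

/-- LEMMA K at the STRUCTURAL threshold `K = 2` (what lineage C's §11(v) «lim inf ≥ 1/4 inside the
structured class» consumes).  RH-FREE; CERTIFIED numerically (in fact with 8.651), not proved in the
kernel. [folklore] -/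
@[conjecture] def ScrewSmoothSectorKTwo : Prop := SmoothSectorKInequality 2

/-- LEMMA K with the CERTIFIED constant `8.4924` (kit j237662, 80-bit balls, radius 4e−13; the
sharper 8.651 of kit j238785 is the constant of record).  RH-FREE; CERTIFIED, not proved in the
kernel. [folklore] -/
@[conjecture] def ScrewSmoothSectorKCertified : Prop := SmoothSectorKInequality (84924 / 10000)

/-- Monotonicity of LEMMA K in the constant. [folklore] -/
theorem smoothSectorKInequality_mono {K K' : ℝ} (hKK' : K ≤ K') (h : SmoothSectorKInequality K') :
    SmoothSectorKInequality K := fun g hg hint =>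
  (mul_le_mul_of_nonneg_right hKK' (sq_nonneg _)).trans (h g hg hint)

/-- The certified constant implies the structural threshold. [folklore] -/
theorem screwSmoothSectorKTwo_of_certified (h : ScrewSmoothSectorKCertified) :
    ScrewSmoothSectorKTwo :=
  smoothSectorKInequality_mono (by norm_num) h

/-! ### Appendix (pivot-theory-1 gen18, HOME/pivot/LEMMA-K-SHARP.md): the SHARP constant `π² − 1`

DERIVED on paper (not in the kernel): replacing the minorant step of lineage C's certified proof by
the zero-free outer factor `Z(w) = ζ(2+w)` (`|Z(−½+it)| = |ζ(3/2+it)|`, `Z^{±1}` bounded on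
`Re w ≥ −½`) after Paley–Wiener identifies the class of Mellin transforms `G` with the whole Hardy
space `H²(Re w > −½)`, the infimum of `κ(h) = ∫₀¹(h−h₀)²y⁻²dy/h₀²` becomes a three-point
minimum-norm interpolation problem with kernel `1/(2π(w + ā + 1))`; its Cauchy matrix
`[[1,2/3,1/2],[2/3,1/2,2/5],[1/2,2/5,1/3]]` has `[C⁻¹]₀₀ = 36`, whence
`inf ∫₀^∞ H²/y² = 36 ζ(2)² h₀²/π² = π² h₀²`, i.e. **`inf κ = π² − 1 = 8.8696…`**, attained in the
energy closure exactly at the lattice-Jordan profile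
`h*(y) = ζ(2) h₀ Σ_{k<1/y} (J₂(k)/k²) Q(ky)`, `Q(v) = −2 + 72v − 160v^{3/2} + 90v²` (numerical check:
`κ(h*) = 8.86954`; lineage C: certified `≥ 8.651`, numerical infimum `8.9 ± 0.05`).  The two `Prop`s
below record the sharp statement; they are typed, not proved here (the Mellin/Paley–Wiener steps
are not available in Mathlib in this form).  RH-FREE; nothing here bears on the truth of RH. -/

/-- LEMMA K, SHARP FORM: the smooth-sector inequality holds with the constant `π² − 1`
(DERIVED on paper: HOME/pivot/LEMMA-K-SHARP.md §1; typed, unproved in the kernel). [folklore] -/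
@[conjecture] def ScrewSmoothSectorKSharp : Prop := SmoothSectorKInequality (Real.pi ^ 2 - 1)

/-- LEMMA K, OPTIMALITY of `π² − 1`: for every larger constant the inequality fails (the
`C¹`-infimum equals `π² − 1` and is approached by `C¹` smoothings of the piecewise-`C¹` extremal
generator `g* = ζ(2)h₀ Σ_{n<1/u} μ(n) n⁻² Q(nu)`; DERIVED on paper, typed only). [folklore] -/
@[conjecture] def ScrewSmoothSectorKOptimal : Prop :=
  ∀ K : ℝ, Real.pi ^ 2 - 1 < K → ¬ SmoothSectorKInequality K

/-- The sharp form implies the certified one (`8.4924 ≤ π² − 1` since `π > 3.14`). [folklore] -/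
theorem screwSmoothSectorKCertified_of_sharp (h : ScrewSmoothSectorKSharp) :
    ScrewSmoothSectorKCertified := by
  refine smoothSectorKInequality_mono ?_ h
  have := Real.pi_gt_d2
  nlinarith

/-! NOTE (rh-columns-ref1 nit p-n2, 2026-08-25). In the appendix docstring above, «numerical check:
κ(h*) = 8.86954» is a TRUNCATED log-grid quadrature of κ(h*) (grid on (10⁻⁵, 1), J₂-sieve to 4·10⁵;
tail + quadrature error ≈ 6·10⁻⁵), quoted as a sanity check of the algebra; read it as
κ(h*) ≈ 8.86954 ± 1e−4.  The exact value is κ(h*) = π² − 1 = 8.8696044…, and since g* is piecewise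
C¹ but not C¹, no ADMISSIBLE generator attains it — there is no tension with
`ScrewSmoothSectorKSharp` / `ScrewSmoothSectorKOptimal`. -/

end Summit.RiemannHypothesis.RiemannHypothesis.Theorems.IntegerScrew
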